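import Literature.AlgebraicGeometry.Motives.AbelianVarietyGoodReductionHom
import HarnessLib

/-!
# Reduction of homomorphisms commutes with composition across three varieties, from Tate compatibility
# along one prime (Shimura 1998, §11.1 Prop. 12 / Prop. 14 (i))

Topic `AlgebraicGeometry/Motives`; namespace `Literature.AlgebraicGeometry.Motives.AbelianVariety.GoodReductionAt.HomReduction`.
PROOF FILE (theorems only) over the reduction-of-homomorphisms data `HomReduction R S` of
`Motives/AbelianVarietyGoodReductionHom.lean` (cell `hodgecm-mathlib`, fan B, row II-1 v2, O-a) — whose fields relate the
reduction of `Hom(A₀, B₀)` to the reductions of ENDOMORPHISMS of `A₀` and of `B₀` only.  For THREE varieties (or the round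
trip `A₀ → B₀ → A₀`) the identity `(f ≫ g)~ = f̃ ≫ g̃` is not a field; here it is DERIVED from `ℓ`-adic specialisation data
ALONG ONE PRIME that are compatible with all the reduction data involved (Shimura's Prop. 14 (i): "`M_l(λ) = M_l(λ̃)`" in the
coordinates given by reduction modulo one `𝔭'`): both sides have the same `T_ℓ` (functoriality of `T_ℓ` and the three
compatibilities), and `T_ℓ` is faithful on `Hom(Ā, C̄)` over the residue field for `v ∤ ℓ` (Milne 1986, Lemma 12.2 =
`hom_ext_of_tateModuleMap_eq`).

* `redHom_comp_redHom_of_isTateCompatible` — three varieties `A₀, B₀, C₀`: `H₁₂.redHom f ≫ H₂₃.redHom g = H₁₃.redHom (f ≫ g)`;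
* `redHom_comp_redHom_eq_redEnd_of_isTateCompatible` — the round trip: `H.redHom f ≫ H'.redHom f' = R.redEnd (f ≫ f')`.

Use: stub S3 `stub_identification` of [Shimura1998] Thm. 18.6 (2) (print p. 129–130: the two-sided `a`-multiplications
`A_i ⇄ A^σ` reduce to scalars whose product is `(m_c ≫ m′_{c′})~ = ι(cc′)~`), and the composition `κ̃ = (λ ≫ θ)~ = λ̃ ≫ θ̃`.
HC_CM is proved only modulo the 7 printed citations until rung 0 closes; this file is unconditional over its data.
-/

noncomputable section

open CategoryTheory IsDedekindDomain
open scoped NumberField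

namespace Literature.AlgebraicGeometry.Motives

namespace AbelianVariety

namespace GoodReductionAt

namespace HomReduction

variable {K : Type} [Field K] [NumberField K] {A₀ B₀ C₀ : AbelianVariety K} {v : HeightOneSpectrum (𝓞 K)}
  {R : A₀.GoodReductionAt v} {S : B₀.GoodReductionAt v} {U : C₀.GoodReductionAt v} {ℓ : ℕ} [Fact ℓ.Prime]

omit [NumberField K] [Fact ℓ.Prime] in
/-- `v ∤ ℓ` iff `ℓ` is non-zero in the residue field `κ(v)` (copy of the private lemma of
`Motives/AbelianVarietyGoodReductionTorsion.lean`). [folklore] -/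
private theorem natCast_residueField_ne_zero (hℓv : (ℓ : 𝓞 K) ∉ v.asIdeal) :
    (ℓ : v.asIdeal.ResidueField) ≠ 0 := by
  rw [← map_natCast (algebraMap (𝓞 K) v.asIdeal.ResidueField) ℓ, Ne, Ideal.algebraMap_residueField_eq_zero]
  exact hℓv

/-- **`(f ≫ g)~ = f̃ ≫ g̃` across three varieties**, for reduction data `H₁₂, H₂₃, H₁₃` of the pairs `(A₀, B₀)`, `(B₀, C₀)`,
`(A₀, C₀)` that are Tate-compatible with the SAME specialisation data `TA, TB, TC` at a place `v ∤ ℓ`: both sides have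
`T_ℓ = TC.equiv ∘ T_ℓ(f ≫ g) ∘ TA.equiv⁻¹`, and `T_ℓ` is faithful on `Hom(Ā, C̄)` (Milne Lemma 12.2).
[cite: Shimura1998, §11.1 Prop. 12 and Prop. 14 (i) (§11, pp. 83–87)] [cite: Milne1986AbelianVarieties, §12 Lemma 12.2 (p. 189)] -/
theorem redHom_comp_redHom_of_isTateCompatible {H₁₂ : HomReduction R S} {H₂₃ : HomReduction S U}
    {H₁₃ : HomReduction R U} {TA : R.TateSpecialisation ℓ} {TB : S.TateSpecialisation ℓ} {TC : U.TateSpecialisation ℓ}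
    (h₁₂ : H₁₂.IsTateCompatible TA TB) (h₂₃ : H₂₃.IsTateCompatible TB TC) (h₁₃ : H₁₃.IsTateCompatible TA TC)
    (hℓv : (ℓ : 𝓞 K) ∉ v.asIdeal) (f : A₀ ⟶ B₀) (g : B₀ ⟶ C₀) :
    H₁₂.redHom f ≫ H₂₃.redHom g = H₁₃.redHom (f ≫ g) := by
  refine hom_ext_of_tateModuleMap_eq ℓ (natCast_residueField_ne_zero hℓv) (LinearMap.ext fun y => ?_)
  obtain ⟨a, rfl⟩ := TA.equiv.surjective y
  rw [tateModuleMap_comp, LinearMap.comp_apply, ← h₁₂ f a, ← h₂₃ g, ← h₁₃ (f ≫ g) a, tateModuleMap_comp,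
    LinearMap.comp_apply]

/-- **The round trip `A₀ → B₀ → A₀`: `f̃ ≫ f̃′ = (f ≫ f′)~` as a reduced ENDOMORPHISM of `A₀`**, for `H : HomReduction R S`,
`H′ : HomReduction S R` Tate-compatible with `(TA, TB)` and `(TB, TA)` respectively at `v ∤ ℓ` (the datum `ofEnd R` is
compatible with `(TA, TA)` by the field `equiv_tateModuleMap`).  Used for the two-sided `a`-multiplications in the proof of
[Shimura1998] Thm. 18.6 (2), step p. 129–130. [cite: Shimura1998, §11.1 Prop. 12 and Prop. 14 (i) (§11, pp. 83–87)]
[cite: Shimura1998, §18.6, proof of Thm. 18.6 (p. 129–130)] -/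
theorem redHom_comp_redHom_eq_redEnd_of_isTateCompatible {H : HomReduction R S} {H' : HomReduction S R}
    {TA : R.TateSpecialisation ℓ} {TB : S.TateSpecialisation ℓ}
    (hH : H.IsTateCompatible TA TB) (hH' : H'.IsTateCompatible TB TA) (hℓv : (ℓ : 𝓞 K) ∉ v.asIdeal)
    (f : A₀ ⟶ B₀) (f' : B₀ ⟶ A₀) :
    H.redHom f ≫ H'.redHom f' = (ofEnd R).redHom (f ≫ f') :=
  redHom_comp_redHom_of_isTateCompatible hH hH' (isTateCompatible_ofEnd TA) hℓv f f'

/-- The same with the right-hand side written through `R.redEnd` (`(ofEnd R).redHom = R.redEnd` by construction).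
[cite: Shimura1998, §11.1 Prop. 12 and Prop. 14 (i) (§11, pp. 83–87)] -/
theorem redHom_comp_redHom_eq_redEnd_of_isTateCompatible' {H : HomReduction R S} {H' : HomReduction S R}
    {TA : R.TateSpecialisation ℓ} {TB : S.TateSpecialisation ℓ}
    (hH : H.IsTateCompatible TA TB) (hH' : H'.IsTateCompatible TB TA) (hℓv : (ℓ : 𝓞 K) ∉ v.asIdeal)
    (f : A₀ ⟶ B₀) (f' : B₀ ⟶ A₀) :
    H.redHom f ≫ H'.redHom f' = (R.redEnd (f ≫ f') : R.reduction ⟶ R.reduction) :=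
  redHom_comp_redHom_eq_redEnd_of_isTateCompatible hH hH' hℓv f f'

end HomReduction

end GoodReductionAt

end AbelianVariety

end Literature.AlgebraicGeometry.Motives

end
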